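import Mathlib
import HarnessLib

/-!
# K2R refutation line, stub `kernelDeloc` — preparatory lemmas (tails of the critical weight)

Route `EnskogAdjointDuality` of `AtomisticToContinuum/HydrodynamicLimit`, crux `AdjointEnskogTestFamilyR`
(stmt-AtomisticToContinuum-11592, "K2R"), line `refutation`, stub `stub_kernelDeloc` (file 1 of 2,
registered sub-goal `stub_kernelDeloc_prep`).

For the critical isotropic weight `ϑ_R(E) = (1+E)⁻³ e^{-E/R}` (energy `E = |U|²`, `R > 0`):

* `k2r_ref_K2_integral_p2` — `∫_x^∞ (1+y)⁻² dy = (1+x)⁻¹`;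
* `k2r_ref_K2_tail` — the exact tail identity `Θ̄_R(x) = ∫_x^∞ ϑ_R = ½(1+x)⁻²e^{-x/R} - (2R)⁻¹ T_R(x)`,
  `T_R(x) = ∫_x^∞ (1+y)⁻² e^{-y/R} dy`, with `0 ≤ T_R(x) ≤ (1+x)⁻¹ e^{-x/R}`, `0 ≤ Θ̄_R(x) ≤ ½(1+x)⁻²`
  (improper integration by parts of `-(1/2)(1+y)⁻² e^{-y/R}`); keyed form `stub_kernelDeloc_prep`;
* `k2r_ref_K2_theta` — a continuous surrogate `Θ̃` of `Θ̄_R` on `ℝ` (equal to it on `[0,∞)`) with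
  `Θ̃' = -ϑ⁺`, `ϑ⁺ = ϑ_R ∘ (· ⊔ 0)`, used for the parametric continuity / integration by parts in `t`;
* `k2r_ref_K2_weight`, `k2r_ref_K2_J`, `k2r_ref_K2_pointwise` — the elementary weight transfer
  `(1+Et²)⁻¹ ≤ 8 e^{E(1-t²)/8}(1+E)⁻¹`, `∫₀¹ e^{-E(1-t)/8} dt ≤ 16/(1+E)` and the resulting pointwise
  bound on the integration-by-parts remainder.

References: elementary real analysis [folklore].
-/

noncomputable section

open MeasureTheory Set Filter Topology
open scoped Real

namespace Summit.AtomisticToContinuum.HydrodynamicLimit.Theorems.EnskogAdjointDuality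

/-! ## The tails `∫_x^∞ (1+y)⁻² dy`, `Θ̄_R`, `T_R` -/

/-- `∫_x^∞ (1+y)⁻² dy = (1+x)⁻¹` for `x > -1`, with integrability. [folklore] -/
theorem k2r_ref_K2_integral_p2 {x : ℝ} (hx : -1 < x) :
    IntegrableOn (fun y : ℝ => ((1 + y) ^ 2)⁻¹) (Ioi x) ∧
      ∫ y in Ioi x, ((1 + y) ^ 2)⁻¹ = (1 + x)⁻¹ := by
  have hderiv : ∀ y ∈ Ici x, HasDerivAt (fun y : ℝ => -(1 + y)⁻¹) (((1 + y) ^ 2)⁻¹) y := by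
    intro y hy
    have hy' : (1 + y) ≠ 0 := by have := mem_Ici.1 hy; intro h0; linarith
    refine ((((hasDerivAt_id' y).const_add 1).fun_inv hy').fun_neg).congr_deriv ?_
    field_simp
  have hpos : ∀ y ∈ Ioi x, (0 : ℝ) ≤ ((1 + y) ^ 2)⁻¹ := fun y _ => by positivity
  have hlim : Tendsto (fun y : ℝ => -(1 + y)⁻¹) atTop (𝓝 0) := by
    have h1 : Tendsto (fun y : ℝ => 1 + y) atTop atTop := tendsto_atTop_add_const_left _ _ tendsto_id
    simpa using (tendsto_inv_atTop_zero.comp h1).neg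
  refine ⟨integrableOn_Ioi_deriv_of_nonneg' hderiv hpos hlim, ?_⟩
  rw [integral_Ioi_of_hasDerivAt_of_nonneg' hderiv hpos hlim]
  simp

/-- `d/dy [-(1/2)(1+y)⁻² e^{-y/R}] = (1+y)⁻³ e^{-y/R} + (2R)⁻¹ (1+y)⁻² e^{-y/R}`. [folklore] -/
theorem k2r_ref_K2_hasDerivAt_half {R y : ℝ} (hR : R ≠ 0) (hy : -1 < y) :
    HasDerivAt (fun y : ℝ => -(1 / 2) * (((1 + y) ^ 2)⁻¹ * Real.exp (-y / R)))
      (((1 + y) ^ 3)⁻¹ * Real.exp (-y / R) + (2 * R)⁻¹ * (((1 + y) ^ 2)⁻¹ * Real.exp (-y / R))) y := by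
  have hy' : (1 + y) ≠ 0 := by intro h0; linarith
  have h1 : HasDerivAt (fun y : ℝ => ((1 + y) ^ 2)⁻¹) (-(2 * (1 + y)) / ((1 + y) ^ 2) ^ 2) y := by
    refine ((((hasDerivAt_id' y).const_add 1).fun_pow 2).fun_inv (pow_ne_zero 2 hy')).congr_deriv ?_
    simp
  have h2 : HasDerivAt (fun y : ℝ => Real.exp (-y / R)) (Real.exp (-y / R) * (-1 / R)) y := by
    simpa using ((hasDerivAt_neg y).div_const R).exp
  refine ((h1.fun_mul h2).const_mul (-(1 / 2) : ℝ)).congr_deriv ?_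
  field_simp
  ring

/-- **Tail package.** For `R > 0`, `x ≥ 0`, with `ϑ(y) = (1+y)⁻³e^{-y/R}`, `q(y) = (1+y)⁻²e^{-y/R}`:
both are integrable on `(x, ∞)`, `∫_x^∞ ϑ = ½ (1+x)⁻² e^{-x/R} - (2R)⁻¹ ∫_x^∞ q`,
`0 ≤ ∫_x^∞ q ≤ (1+x)⁻¹ e^{-x/R}` and `0 ≤ ∫_x^∞ ϑ ≤ ½ (1+x)⁻²`. [folklore] -/
theorem k2r_ref_K2_tail {R x : ℝ} (hR : 0 < R) (hx : 0 ≤ x) :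
    IntegrableOn (fun y : ℝ => ((1 + y) ^ 3)⁻¹ * Real.exp (-y / R)) (Ioi x) ∧
    IntegrableOn (fun y : ℝ => ((1 + y) ^ 2)⁻¹ * Real.exp (-y / R)) (Ioi x) ∧
    (∫ y in Ioi x, ((1 + y) ^ 3)⁻¹ * Real.exp (-y / R)) =
      1 / 2 * (((1 + x) ^ 2)⁻¹ * Real.exp (-x / R))
        - (2 * R)⁻¹ * ∫ y in Ioi x, ((1 + y) ^ 2)⁻¹ * Real.exp (-y / R) ∧
    (0 ≤ ∫ y in Ioi x, ((1 + y) ^ 2)⁻¹ * Real.exp (-y / R)) ∧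
    (∫ y in Ioi x, ((1 + y) ^ 2)⁻¹ * Real.exp (-y / R)) ≤ (1 + x)⁻¹ * Real.exp (-x / R) ∧
    (0 ≤ ∫ y in Ioi x, ((1 + y) ^ 3)⁻¹ * Real.exp (-y / R)) ∧
    (∫ y in Ioi x, ((1 + y) ^ 3)⁻¹ * Real.exp (-y / R)) ≤ 1 / 2 * ((1 + x) ^ 2)⁻¹ := by
  obtain ⟨hp2i, hp2⟩ := k2r_ref_K2_integral_p2 (show (-1 : ℝ) < x by linarith)
  have hne : ∀ y ∈ Ioi x, (1 + y : ℝ) ≠ 0 := fun y hy => by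
    have := mem_Ioi.1 hy; intro h0; linarith
  have hexp1 : ∀ y ∈ Ioi x, Real.exp (-y / R) ≤ 1 := fun y hy => by
    have hy0 : 0 ≤ y := hx.trans (mem_Ioi.1 hy).le
    rw [Real.exp_le_one_iff, neg_div]; exact neg_nonpos.2 (by positivity)
  have hcont : ∀ n : ℕ, ContinuousOn (fun y : ℝ => ((1 + y) ^ n)⁻¹ * Real.exp (-y / R)) (Ioi x) :=
    fun n => (((continuousOn_const.add continuousOn_id).pow n).inv₀
      (fun y hy => pow_ne_zero n (hne y hy))).mul (Continuous.continuousOn (by fun_prop))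
  -- domination by `(1+y)⁻²`
  have hdom : ∀ n : ℕ, 2 ≤ n → ∀ y ∈ Ioi x,
      ‖((1 + y) ^ n)⁻¹ * Real.exp (-y / R)‖ ≤ ((1 + y) ^ 2)⁻¹ := by
    intro n hn y hy
    have hy1 : (1 : ℝ) ≤ 1 + y := by have := mem_Ioi.1 hy; linarith
    rw [Real.norm_eq_abs, abs_of_nonneg (by positivity)]
    calc ((1 + y) ^ n)⁻¹ * Real.exp (-y / R) ≤ ((1 + y) ^ n)⁻¹ * 1 := by
          gcongr; exact hexp1 y hy
      _ ≤ ((1 + y) ^ 2)⁻¹ := by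
          rw [mul_one]; exact inv_anti₀ (by positivity) (pow_le_pow_right₀ hy1 hn)
  have hint : ∀ n : ℕ, 2 ≤ n →
      IntegrableOn (fun y : ℝ => ((1 + y) ^ n)⁻¹ * Real.exp (-y / R)) (Ioi x) := fun n hn =>
    Integrable.mono' hp2i ((hcont n).aestronglyMeasurable measurableSet_Ioi)
      ((ae_restrict_iff' measurableSet_Ioi).2 (Eventually.of_forall (hdom n hn)))
  have hI3 := hint 3 (by norm_num)
  have hI2 := hint 2 le_rfl
  -- the closed form by an improper integration by parts
  have hderiv : ∀ y ∈ Ici x, HasDerivAt (fun y : ℝ => -(1 / 2) * (((1 + y) ^ 2)⁻¹ * Real.exp (-y / R)))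
      (((1 + y) ^ 3)⁻¹ * Real.exp (-y / R) + (2 * R)⁻¹ * (((1 + y) ^ 2)⁻¹ * Real.exp (-y / R))) y :=
    fun y hy => k2r_ref_K2_hasDerivAt_half hR.ne' (by have := mem_Ici.1 hy; linarith)
  have hpos : ∀ y ∈ Ioi x,
      0 ≤ ((1 + y) ^ 3)⁻¹ * Real.exp (-y / R) + (2 * R)⁻¹ * (((1 + y) ^ 2)⁻¹ * Real.exp (-y / R)) := by
    intro y hy
    have : 0 < 1 + y := by have := mem_Ioi.1 hy; linarith
    positivity
  have hlim : Tendsto (fun y : ℝ => -(1 / 2) * (((1 + y) ^ 2)⁻¹ * Real.exp (-y / R))) atTop (𝓝 0) := by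
    have h1 : Tendsto (fun y : ℝ => 1 + y) atTop atTop := tendsto_atTop_add_const_left _ _ tendsto_id
    have h2 : Tendsto (fun y : ℝ => ((1 + y) ^ 2)⁻¹) atTop (𝓝 0) :=
      tendsto_inv_atTop_zero.comp ((tendsto_pow_atTop two_ne_zero).comp h1)
    have h3 : Tendsto (fun y : ℝ => Real.exp (-y / R)) atTop (𝓝 0) := by
      refine (Real.tendsto_exp_neg_atTop_nhds_zero.comp (tendsto_id.atTop_div_const hR)).congr'
        (Eventually.of_forall fun y => ?_)
      simp [neg_div]
    simpa using (h2.mul h3).const_mul (-(1 / 2) : ℝ)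
  have hclosed := integral_Ioi_of_hasDerivAt_of_nonneg' hderiv hpos hlim
  rw [integral_add hI3 (hI2.const_mul _), integral_const_mul] at hclosed
  have hT0 : 0 ≤ ∫ y in Ioi x, ((1 + y) ^ 2)⁻¹ * Real.exp (-y / R) :=
    setIntegral_nonneg measurableSet_Ioi fun y hy => by
      have : 0 < 1 + y := by have := mem_Ioi.1 hy; linarith
      positivity
  have hT1 : (∫ y in Ioi x, ((1 + y) ^ 2)⁻¹ * Real.exp (-y / R)) ≤ (1 + x)⁻¹ * Real.exp (-x / R) := by
    calc (∫ y in Ioi x, ((1 + y) ^ 2)⁻¹ * Real.exp (-y / R))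
        ≤ ∫ y in Ioi x, Real.exp (-x / R) * ((1 + y) ^ 2)⁻¹ := by
          refine setIntegral_mono_on hI2 (hp2i.const_mul _) measurableSet_Ioi fun y hy => ?_
          rw [mul_comm]
          refine mul_le_mul_of_nonneg_right (Real.exp_le_exp.2 ?_) (by positivity)
          have := (mem_Ioi.1 hy).le
          rw [neg_div, neg_div, neg_le_neg_iff]
          gcongr
      _ = (1 + x)⁻¹ * Real.exp (-x / R) := by rw [integral_const_mul, hp2, mul_comm]
  have hΘ0 : 0 ≤ ∫ y in Ioi x, ((1 + y) ^ 3)⁻¹ * Real.exp (-y / R) :=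
    setIntegral_nonneg measurableSet_Ioi fun y hy => by
      have : 0 < 1 + y := by have := mem_Ioi.1 hy; linarith
      positivity
  have hmain : (∫ y in Ioi x, ((1 + y) ^ 3)⁻¹ * Real.exp (-y / R)) =
      1 / 2 * (((1 + x) ^ 2)⁻¹ * Real.exp (-x / R))
        - (2 * R)⁻¹ * ∫ y in Ioi x, ((1 + y) ^ 2)⁻¹ * Real.exp (-y / R) := by
    linarith
  refine ⟨hI3, hI2, hmain, hT0, hT1, hΘ0, ?_⟩
  have hex : Real.exp (-x / R) ≤ 1 := by
    rw [Real.exp_le_one_iff, neg_div]; exact neg_nonpos.2 (by positivity)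
  have h1 : ((1 + x) ^ 2)⁻¹ * Real.exp (-x / R) ≤ ((1 + x) ^ 2)⁻¹ :=
    mul_le_of_le_one_right (by positivity) hex
  have h2 : 0 ≤ (2 * R)⁻¹ * ∫ y in Ioi x, ((1 + y) ^ 2)⁻¹ * Real.exp (-y / R) := by positivity
  linarith

/-- **Continuous surrogate of the tail.** For `R > 0` there are continuous `Θ̃, ϑ⁺ : ℝ → ℝ` with
`Θ̃' = -ϑ⁺` everywhere, agreeing on `[0, ∞)` with `Θ̄_R(x) = ∫_x^∞ ϑ_R` and `ϑ_R`, and obeying there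
`0 ≤ Θ̃ ≤ ½ (1+x)⁻²`, `0 ≤ ϑ⁺ ≤ (1+x)⁻³`. [folklore] -/
theorem k2r_ref_K2_theta {R : ℝ} (hR : 0 < R) :
    ∃ Θt ϑp : ℝ → ℝ, Continuous Θt ∧ Continuous ϑp ∧ (∀ x, HasDerivAt Θt (-ϑp x) x) ∧
      (∀ x, 0 ≤ x → Θt x = ∫ y in Ioi x, ((1 + y) ^ 3)⁻¹ * Real.exp (-y / R)) ∧
      (∀ x, 0 ≤ x → 0 ≤ Θt x ∧ Θt x ≤ 1 / 2 * ((1 + x) ^ 2)⁻¹) ∧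
      (∀ x, 0 ≤ x → 0 ≤ ϑp x ∧ ϑp x ≤ ((1 + x) ^ 3)⁻¹) := by
  obtain ⟨ϑp, hϑp⟩ : ∃ ϑp : ℝ → ℝ,
      ϑp = fun y => ((1 + max y 0) ^ 3)⁻¹ * Real.exp (-(max y 0) / R) := ⟨_, rfl⟩
  have hϑc : Continuous ϑp := by
    rw [hϑp]
    exact Continuous.mul (Continuous.inv₀ (by fun_prop) fun y => by positivity) (by fun_prop)
  have hϑeq : ∀ y, 0 ≤ y → ϑp y = ((1 + y) ^ 3)⁻¹ * Real.exp (-y / R) := fun y hy => by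
    simp [hϑp, max_eq_left hy]
  set C0 : ℝ := ∫ y in Ioi (0 : ℝ), ((1 + y) ^ 3)⁻¹ * Real.exp (-y / R) with hC0
  have hΘeq : ∀ x, 0 ≤ x →
      C0 - ∫ y in (0 : ℝ)..x, ϑp y = ∫ y in Ioi x, ((1 + y) ^ 3)⁻¹ * Real.exp (-y / R) := by
    intro x hx
    obtain ⟨hI3, -⟩ := k2r_ref_K2_tail hR le_rfl
    have hsplit : C0 = (∫ y in (0 : ℝ)..x, ((1 + y) ^ 3)⁻¹ * Real.exp (-y / R))
        + ∫ y in Ioi x, ((1 + y) ^ 3)⁻¹ * Real.exp (-y / R) := by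
      rw [intervalIntegral.integral_of_le hx, ← setIntegral_union (Ioc_disjoint_Ioi le_rfl)
        measurableSet_Ioi (hI3.mono_set Ioc_subset_Ioi_self) (hI3.mono_set (Ioi_subset_Ioi hx)),
        Ioc_union_Ioi_eq_Ioi hx]
    have hcongr : ∫ y in (0 : ℝ)..x, ϑp y = ∫ y in (0 : ℝ)..x, ((1 + y) ^ 3)⁻¹ * Real.exp (-y / R) := by
      refine intervalIntegral.integral_congr fun y hy => ?_
      rw [uIcc_of_le hx] at hy
      exact hϑeq y hy.1
    rw [hcongr, hsplit]; ring
  refine ⟨fun x => C0 - ∫ y in (0 : ℝ)..x, ϑp y, ϑp, ?_, hϑc, ?_, hΘeq, ?_, ?_⟩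
  · exact continuous_const.sub (intervalIntegral.continuous_primitive
      (fun a b => hϑc.intervalIntegrable a b) 0)
  · intro x
    exact (hϑc.integral_hasStrictDerivAt 0 x).hasDerivAt.const_sub C0
  · intro x hx
    obtain ⟨-, -, -, -, -, h0, h1⟩ := k2r_ref_K2_tail hR hx
    dsimp only
    rw [hΘeq x hx]
    exact ⟨h0, h1⟩
  · intro x hx
    rw [hϑeq x hx]
    have hex : Real.exp (-x / R) ≤ 1 := by
      rw [Real.exp_le_one_iff, neg_div]; exact neg_nonpos.2 (by positivity)
    exact ⟨by positivity, mul_le_of_le_one_right (by positivity) hex⟩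

/-! ## The integration by parts in `t` and its remainder -/

/-- Weight transfer: if `s, w ≥ 0`, `s + w = E` then `(1+s)⁻² ≤ 64 e^{w/4} (1+E)⁻²` and
`(1+s)⁻³ ≤ 512 e^{3w/8} (1+E)⁻³` (from `1+E ≤ (1+s)(1+w) ≤ 8 (1+s) e^{w/8}`). [folklore] -/
theorem k2r_ref_K2_weight {E s w : ℝ} (hs : 0 ≤ s) (hw : 0 ≤ w) (hsw : s + w = E) :
    ((1 + s) ^ 2)⁻¹ ≤ 64 * Real.exp (w / 4) * ((1 + E) ^ 2)⁻¹ ∧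
    ((1 + s) ^ 3)⁻¹ ≤ 512 * Real.exp (3 * w / 8) * ((1 + E) ^ 3)⁻¹ := by
  have hexp := Real.add_one_le_exp (w / 8)
  have h1 : 1 + E ≤ 8 * Real.exp (w / 8) * (1 + s) := by nlinarith [mul_nonneg hs hw]
  have hE1 : 0 < 1 + E := by linarith
  have hs1 : 0 < 1 + s := by linarith
  have key : ∀ n : ℕ, ((1 + s) ^ n)⁻¹ ≤ (8 * Real.exp (w / 8)) ^ n * ((1 + E) ^ n)⁻¹ := by
    intro n
    have h2 : (1 + E) ^ n ≤ (8 * Real.exp (w / 8)) ^ n * (1 + s) ^ n := by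
      rw [← mul_pow]; exact pow_le_pow_left₀ hE1.le h1 n
    rw [← div_eq_mul_inv, le_div_iff₀ (pow_pos hE1 n)]
    calc ((1 + s) ^ n)⁻¹ * (1 + E) ^ n ≤ ((1 + s) ^ n)⁻¹ * ((8 * Real.exp (w / 8)) ^ n * (1 + s) ^ n) := by
          gcongr
      _ = (8 * Real.exp (w / 8)) ^ n := by field_simp
  have he2 : Real.exp (w / 8) ^ 2 = Real.exp (w / 4) := by
    rw [← Real.exp_nat_mul]; congr 1; push_cast; ring
  have he3 : Real.exp (w / 8) ^ 3 = Real.exp (3 * w / 8) := by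
    rw [← Real.exp_nat_mul]; congr 1; push_cast; ring
  refine ⟨(key 2).trans_eq ?_, (key 3).trans_eq ?_⟩
  · rw [mul_pow, he2]; norm_num
  · rw [mul_pow, he3]; norm_num

/-- `∫₀¹ e^{-E(1-t)/8} dt = (8/E)(1 - e^{-E/8}) ≤ 16/(1+E)` for `E > 0`. [folklore] -/
theorem k2r_ref_K2_J {E : ℝ} (hE : 0 < E) :
    ∫ t in (0 : ℝ)..1, Real.exp (-(E * (1 - t)) / 8) ≤ 16 / (1 + E) := by
  have hderiv : ∀ t ∈ uIcc (0 : ℝ) 1, HasDerivAt (fun t : ℝ => 8 / E * Real.exp (-(E * (1 - t)) / 8))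
      (Real.exp (-(E * (1 - t)) / 8)) t := by
    intro t _
    have h1 : HasDerivAt (fun t : ℝ => -(E * (1 - t)) / 8) (E / 8) t := by
      refine ((((hasDerivAt_const t (1 : ℝ)).fun_sub (hasDerivAt_id' t)).const_mul E).fun_neg.div_const
        8).congr_deriv ?_
      ring
    refine (h1.exp.const_mul (8 / E)).congr_deriv ?_
    field_simp
  rw [intervalIntegral.integral_eq_sub_of_hasDerivAt hderiv
    (Continuous.intervalIntegrable (by fun_prop) _ _)]
  have he := Real.add_one_le_exp (-E / 8)
  have he1 : Real.exp (-E / 8) ≤ 1 := by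
    rw [Real.exp_le_one_iff]; linarith
  have hE1 : 0 < 1 + E := by linarith
  have he0 := Real.exp_pos (-E / 8)
  have key : 8 * (1 - Real.exp (-E / 8)) * (1 + E) ≤ 16 * E := by
    rcases le_or_gt E 1 with h | h
    · nlinarith
    · nlinarith [mul_pos he0 hE1]
  simp only [sub_self, mul_zero, neg_zero, zero_div, Real.exp_zero, mul_one, sub_zero]
  rw [show 8 / E - 8 / E * Real.exp (-E / 8) = 8 * (1 - Real.exp (-E / 8)) / E by ring,
    div_le_div_iff₀ hE hE1]
  linarith

/-- Pointwise bound for the integration-by-parts remainder: for `E > 0`, `t ∈ [0,1]`,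
`0 ≤ Θ ≤ ½(1+Et²)⁻²`, `0 ≤ ϑ ≤ (1+Et²)⁻³`,
`|(Θ - 2Et²ϑ) e^{-E(1-t²)/2}/E| ≤ 1056 (1+E)⁻² E⁻¹ e^{-E(1-t)/8}`. [folklore] -/
theorem k2r_ref_K2_pointwise {E t Θ ϑ : ℝ} (hE : 0 < E) (ht0 : 0 ≤ t) (ht1 : t ≤ 1)
    (hΘ0 : 0 ≤ Θ) (hΘ1 : Θ ≤ 1 / 2 * ((1 + E * t ^ 2) ^ 2)⁻¹)
    (hϑ0 : 0 ≤ ϑ) (hϑ1 : ϑ ≤ ((1 + E * t ^ 2) ^ 3)⁻¹) :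
    |(Θ - 2 * E * t ^ 2 * ϑ) * (Real.exp (-(E * (1 - t ^ 2)) / 2) / E)|
      ≤ 1056 * ((1 + E) ^ 2)⁻¹ / E * Real.exp (-(E * (1 - t)) / 8) := by
  have ht2 : t ^ 2 ≤ 1 := pow_le_one₀ ht0 ht1
  have hs0 : 0 ≤ E * t ^ 2 := by positivity
  have hw0 : 0 ≤ E * (1 - t ^ 2) := mul_nonneg hE.le (by linarith)
  obtain ⟨h2, h3⟩ := k2r_ref_K2_weight hs0 hw0 (show E * t ^ 2 + E * (1 - t ^ 2) = E by ring)
  have hE1 : 0 < 1 + E := by linarith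
  -- `s (1+E)⁻³ ≤ (1+E)⁻²`
  have hp3 : E * t ^ 2 * ((1 + E) ^ 3)⁻¹ ≤ ((1 + E) ^ 2)⁻¹ := by
    rw [← div_eq_mul_inv, div_le_iff₀ (pow_pos hE1 3)]
    calc E * t ^ 2 ≤ E * 1 := by gcongr
      _ ≤ ((1 + E) ^ 2)⁻¹ * (1 + E) ^ 3 := by field_simp; linarith
  have e1 : Real.exp (E * (1 - t ^ 2) / 4) * Real.exp (-(E * (1 - t ^ 2)) / 2)
      = Real.exp (-(E * (1 - t ^ 2)) / 4) := by rw [← Real.exp_add]; ring_nf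
  have e2 : Real.exp (3 * (E * (1 - t ^ 2)) / 8) * Real.exp (-(E * (1 - t ^ 2)) / 2)
      = Real.exp (-(E * (1 - t ^ 2)) / 8) := by rw [← Real.exp_add]; ring_nf
  have e3 : Real.exp (-(E * (1 - t ^ 2)) / 4) ≤ Real.exp (-(E * (1 - t ^ 2)) / 8) :=
    Real.exp_le_exp.2 (by linarith)
  have e4 : Real.exp (-(E * (1 - t ^ 2)) / 8) ≤ Real.exp (-(E * (1 - t)) / 8) :=
    Real.exp_le_exp.2 (by nlinarith [mul_nonneg ht0 (sub_nonneg.2 ht1)])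
  have hv : 0 < Real.exp (-(E * (1 - t ^ 2)) / 2) / E := by positivity
  rw [abs_mul, abs_of_pos hv]
  have hA : |Θ - 2 * E * t ^ 2 * ϑ| ≤ Θ + 2 * (E * t ^ 2) * ϑ := by
    refine (abs_sub _ _).trans ?_
    rw [abs_of_nonneg hΘ0, abs_of_nonneg (by positivity)]; ring_nf; rfl
  calc |Θ - 2 * E * t ^ 2 * ϑ| * (Real.exp (-(E * (1 - t ^ 2)) / 2) / E)
      ≤ (Θ + 2 * (E * t ^ 2) * ϑ) * (Real.exp (-(E * (1 - t ^ 2)) / 2) / E) := by gcongr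
    _ ≤ (1 / 2 * (64 * Real.exp (E * (1 - t ^ 2) / 4) * ((1 + E) ^ 2)⁻¹)
          + 2 * (E * t ^ 2) * (512 * Real.exp (3 * (E * (1 - t ^ 2)) / 8) * ((1 + E) ^ 3)⁻¹))
          * (Real.exp (-(E * (1 - t ^ 2)) / 2) / E) := by
        gcongr
        · exact hΘ1.trans (mul_le_mul_of_nonneg_left h2 (by norm_num))
        · exact hϑ1.trans h3
    _ = (32 * Real.exp (-(E * (1 - t ^ 2)) / 4) * ((1 + E) ^ 2)⁻¹
          + 1024 * Real.exp (-(E * (1 - t ^ 2)) / 8) * (E * t ^ 2 * ((1 + E) ^ 3)⁻¹)) / E := by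
        rw [← e1, ← e2]; ring
    _ ≤ (32 * Real.exp (-(E * (1 - t ^ 2)) / 8) * ((1 + E) ^ 2)⁻¹
          + 1024 * Real.exp (-(E * (1 - t ^ 2)) / 8) * ((1 + E) ^ 2)⁻¹) / E := by
        gcongr
    _ = 1056 * ((1 + E) ^ 2)⁻¹ / E * Real.exp (-(E * (1 - t ^ 2)) / 8) := by ring
    _ ≤ 1056 * ((1 + E) ^ 2)⁻¹ / E * Real.exp (-(E * (1 - t)) / 8) := by gcongr

/-- **Registered sub-goal `stub_kernelDeloc_prep`**: the exact tail identity
`∫_x^∞ (1+y)⁻³e^{-y/R} dy = ½(1+x)⁻²e^{-x/R} - (2R)⁻¹ ∫_x^∞ (1+y)⁻²e^{-y/R} dy` (`R > 0`, `x ≥ 0`).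
[folklore] -/
theorem stub_kernelDeloc_prep : ∀ R x : ℝ, 0 < R → 0 ≤ x → (∫ y in Set.Ioi x, ((1 + y) ^ 3)⁻¹ * Real.exp (-y / R)) = 1 / 2 * (((1 + x) ^ 2)⁻¹ * Real.exp (-x / R)) - (2 * R)⁻¹ * ∫ y in Set.Ioi x, ((1 + y) ^ 2)⁻¹ * Real.exp (-y / R) :=
  fun _ _ hR hx => (k2r_ref_K2_tail hR hx).2.2.1

end Summit.AtomisticToContinuum.HydrodynamicLimit.Theorems.EnskogAdjointDuality
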